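import Summits.AnomalousDissipation.AnomalousDissipation.Theses.MirrorVariety
import Summits.AnomalousDissipation.AnomalousDissipation.Theorems.TaylorGreenLoudGalerkinStates.Negative.Anatomy

/-!
# Route MirrorVariety (AnomalousDissipation) — `TaylorGreenFeedsTarget`

Settles stmt-AnomalousDissipation-14162 (support item `TaylorGreenFeedsTarget` of route
`AnomalousDissipation/MirrorVariety`): the bookkeeping edge crux #2 → thesis X,
`TaylorGreenLoudGalerkinStates → GalerkinSteadyZerothLaw`.

Proof: instantiate the crux at its own force `f := f_TG`
(`Theorems.TaylorGreenLoudGalerkinStates.Negative.tgForce`, definitionally the crux's lambda), which is smooth,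
divergence-free and mean-zero by the landed lemmas `Negative.isSmooth_tgForce`, `Negative.isDivFree_tgForce`,
`Negative.hasZeroMean_tgForce` (`Theorems/TaylorGreenLoudGalerkinStates/Negative/Anatomy.lean`: `f_TG` is an explicit
real trigonometric polynomial on the shell `|k|² = 3`); keep `ν, E, ε` verbatim; the state bracket, energy bound and
loudness clause of crux and target are syntactically identical, and `∀ᶠ N in atTop ⇒ ∃ᶠ N in atTop` is
`Filter.Eventually.frequently` (`atTop` on `ℕ` is `NeBot`). No analysis is involved.

References: M. E. Brachet et al., *Small-scale structure of the Taylor–Green vortex*, J. Fluid Mech. 130 (1983), §2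
(the Taylor–Green force); R. Temam, *Navier–Stokes Equations* (1979), Ch. II §1 (tested steady form).
-/

-- `Summit.<Summit>.<Problem>` is the tree's mandated summit-side namespace (CONVENTIONS §2); for this
-- single-conjunct summit the two coincide, so the duplicate is deliberate.
set_option linter.dupNamespace false

noncomputable section

open Filter

namespace Summit.AnomalousDissipation.AnomalousDissipation.Theorems

open Summit.AnomalousDissipation.AnomalousDissipation.Theses.MirrorVariety
open Summit.AnomalousDissipation.AnomalousDissipation.Theorems.TaylorGreenLoudGalerkinStates.Negative

/-- **Crux #2 feeds the target** (stmt-AnomalousDissipation-14162): loud bounded Galerkin steady states for the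
Taylor–Green force at all large resolutions (`TaylorGreenLoudGalerkinStates`) give the Galerkin steady zeroth law
(`GalerkinSteadyZerothLaw`) with the witness force `f := f_TG` — smooth, divergence-free, mean-zero — the same
`ν, E, ε`, and `∀ᶠ N ⇒ ∃ᶠ N`. [folklore] -/
theorem taylorGreenFeedsTarget_proof :
    Summit.AnomalousDissipation.AnomalousDissipation.Theses.MirrorVariety.TaylorGreenFeedsTarget := by
  unfold TaylorGreenFeedsTarget
  intro h
  obtain ⟨ν, E, ε, hν, hν0, hε, hloud⟩ := h tgForce rfl
  exact ⟨tgForce, isSmooth_tgForce, isDivFree_tgForce, hasZeroMean_tgForce, ν, E, ε, hν, hν0, hε,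
    fun j => (hloud j).frequently⟩

end Summit.AnomalousDissipation.AnomalousDissipation.Theorems

end
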